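import Summits.Ventures.PercRepro.RLSRuleProfileSums
import Summits.Ventures.PercRepro.RLSRuleT1Tools

/-!
# C-025 at q = 3: the `6`-point plane with one `3`-point line — family and accounting (night-3, gen 4)

The first plane OUTSIDE `𝒯₀` handled by the profile machine: `G = ℓ ∪ {a, b, c}` (`OneLine M G ℓ`, `|G| = 6`,
catalogue #10).  Its `41` rank-`3` subsets: `19` independent triples, `15` four-subsets (`3` through `ℓ`), `6`
five-subsets (`3` through `ℓ`), and `G` itself — a winner (`≥ 6` points).

* `depTriples_eq_singleton_of_oneLine`; `filter_five_line_eq_image`, `card_filter_four_line_six`,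
  `card_filter_five_line_six` — the subsets through `ℓ`; `oneLineSix_family` — ranks, disjointness, cards;
* `oneLineSix_supply` — the profile accounting with the line charged its `(L3)` loss on every subset through it
  (`Λ = {ℓ}`), in the abstract witness sums `T₀, T₁, T₂, W` and loss sums `L₁, L₂, L_W` of the witness family;
* `oneLineSix_supply_free` — the same with no loss (`Λ = ∅`, the types `t ≥ 2`).
Imports `RLSRuleProfileSums`, `RLSRuleT1Tools`.  Axioms: standard.
-/

open scoped Matroid

namespace PercRepro

namespace NightThree

open Finset ThmH PerFlat

variable {α : Type*} [DecidableEq α] {M : Matroid α} [M.Finite]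

open scoped Classical in
omit [M.Finite] in
/-- The dependent triples of a `OneLine` plane are exactly its line. -/
theorem depTriples_eq_singleton_of_oneLine {G ℓ : Finset α} (h : OneLine M G ℓ) : depTriples M G = {ℓ} := by
  obtain ⟨hℓG, hℓc, hℓr, hone⟩ := h
  ext T
  unfold depTriples
  rw [Finset.mem_filter, Finset.mem_powersetCard, Finset.mem_singleton]
  constructor
  · rintro ⟨⟨hTG, hTc⟩, hdep⟩
    by_contra hne
    exact hdep (hone T (Finset.mem_powersetCard.2 ⟨hTG, hTc⟩) hne)
  · rintro rfl
    exact ⟨⟨hℓG, hℓc⟩, not_indep_of_eRk_two_card_three hℓr hℓc⟩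

omit [M.Finite] in
/-- The `5`-subsets of `G` through a `3`-point line `ℓ ⊆ G` are the sets `ℓ ∪ P`, `P` a pair of `G ∖ ℓ`. -/
theorem filter_five_line_eq_image {G ℓ : Finset α} (hℓG : ℓ ⊆ G) (hℓc : ℓ.card = 3) :
    (G.powersetCard 5).filter (fun B => ℓ ⊆ B) = ((G \ ℓ).powersetCard 2).image (fun P => ℓ ∪ P) := by
  classical
  ext B
  rw [Finset.mem_filter, Finset.mem_powersetCard, Finset.mem_image]
  constructor
  · rintro ⟨⟨hBG, hBc⟩, hℓB⟩
    refine ⟨B \ ℓ, ?_, ?_⟩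
    · rw [Finset.mem_powersetCard]
      refine ⟨Finset.sdiff_subset_sdiff hBG le_rfl, ?_⟩
      rw [Finset.card_sdiff_of_subset hℓB, hBc, hℓc]
    · exact Finset.union_sdiff_of_subset hℓB
  · rintro ⟨P, hP, rfl⟩
    rw [Finset.mem_powersetCard] at hP
    have hPG : P ⊆ G := hP.1.trans Finset.sdiff_subset
    have hdisj : Disjoint ℓ P := Finset.disjoint_of_subset_right hP.1 Finset.disjoint_sdiff
    refine ⟨⟨Finset.union_subset hℓG hPG, ?_⟩, Finset.subset_union_left⟩
    rw [Finset.card_union_of_disjoint hdisj, hℓc, hP.2]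

omit [M.Finite] in
/-- On a `6`-point plane there are exactly `3` four-subsets through a `3`-point line. -/
theorem card_filter_four_line_six {G ℓ : Finset α} (hℓG : ℓ ⊆ G) (hℓc : ℓ.card = 3) (hGc : G.card = 6) :
    ((G.powersetCard 4).filter (fun B => ℓ ⊆ B)).card = 3 := by
  classical
  rw [filter_four_line_eq_image hℓG hℓc, Finset.card_image_of_injOn, Finset.card_sdiff_of_subset hℓG, hGc, hℓc]
  intro b hb b' hb' h
  rw [Finset.mem_coe, Finset.mem_sdiff] at hb hb'
  dsimp only at h
  have : b ∈ insert b' ℓ := by rw [← h]; exact Finset.mem_insert_self _ _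
  rw [Finset.mem_insert] at this
  rcases this with h1 | h1
  · exact h1
  · exact absurd h1 hb.2

omit [M.Finite] in
/-- On a `6`-point plane there are exactly `3` five-subsets through a `3`-point line. -/
theorem card_filter_five_line_six {G ℓ : Finset α} (hℓG : ℓ ⊆ G) (hℓc : ℓ.card = 3) (hGc : G.card = 6) :
    ((G.powersetCard 5).filter (fun B => ℓ ⊆ B)).card = 3 := by
  classical
  rw [filter_five_line_eq_image hℓG hℓc, Finset.card_image_of_injOn, Finset.card_powersetCard,
    Finset.card_sdiff_of_subset hℓG, hGc, hℓc]
  · rfl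
  · intro P hP P' hP' h
    rw [Finset.mem_coe, Finset.mem_powersetCard] at hP hP'
    dsimp only at h
    have h1 : Disjoint ℓ P := Finset.disjoint_of_subset_right hP.1 Finset.disjoint_sdiff
    have h2 : Disjoint ℓ P' := Finset.disjoint_of_subset_right hP'.1 Finset.disjoint_sdiff
    rw [← Finset.union_sdiff_cancel_left h1, ← Finset.union_sdiff_cancel_left h2, h]

/-- The family of rank-`3` subsets of the plane `ℓ ∪ {a, b, c}`: ranks, disjointness, cards. -/
theorem oneLineSix_family {p : ℕ} (hc : Core M p) {G ℓ : Finset α} (hG : G ∈ flatsQ M 3) (h : OneLine M G ℓ)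
    (hGc : G.card = 6) :
    (∀ B ∈ (G.powersetCard 3).erase ℓ, B ⊆ G ∧ B.card = 3 ∧ ¬ ℓ ⊆ B ∧ M.Indep (B : Set α)) ∧
    (∀ B ∈ (G.powersetCard 3).erase ℓ ∪ G.powersetCard 4 ∪ G.powersetCard 5 ∪ {G},
      B ⊆ G ∧ M.eRk (B : Set α) = 3) ∧
    Disjoint ((G.powersetCard 3).erase ℓ) (G.powersetCard 4) ∧
    Disjoint ((G.powersetCard 3).erase ℓ ∪ G.powersetCard 4) (G.powersetCard 5) ∧
    Disjoint ((G.powersetCard 3).erase ℓ ∪ G.powersetCard 4 ∪ G.powersetCard 5) {G} ∧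
    ((G.powersetCard 3).erase ℓ).card = 19 ∧ (G.powersetCard 4).card = 15 ∧ (G.powersetCard 5).card = 6 := by
  classical
  obtain ⟨hℓG, hℓc, hℓr, hone⟩ := h
  have hG3 : M.eRk (G : Set α) = 3 := eRk_eq_three_of_mem_flatsQ' hG
  have hmem3 : ∀ B ∈ (G.powersetCard 3).erase ℓ, B ⊆ G ∧ B.card = 3 ∧ ¬ ℓ ⊆ B ∧ M.Indep (B : Set α) := by
    intro B hB
    rw [Finset.mem_erase, Finset.mem_powersetCard] at hB
    obtain ⟨hBℓ, hBG, hBc⟩ := hB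
    refine ⟨hBG, hBc, ?_, hone B (Finset.mem_powersetCard.2 ⟨hBG, hBc⟩) hBℓ⟩
    intro hl; exact hBℓ (Finset.eq_of_subset_of_card_le hl (by omega)).symm
  have hc4 : ∀ B ∈ G.powersetCard 4, B.card = 4 := fun B hB => (Finset.mem_powersetCard.1 hB).2
  have hc5 : ∀ B ∈ G.powersetCard 5, B.card = 5 := fun B hB => (Finset.mem_powersetCard.1 hB).2
  refine ⟨hmem3, ?_, ?_, ?_, ?_, ?_, ?_, ?_⟩
  · intro B hB
    simp only [Finset.mem_union, Finset.mem_singleton] at hB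
    rcases hB with ((hB | hB) | hB) | hBG'
    · obtain ⟨hBG, hBc, _, hBind⟩ := hmem3 B hB
      exact ⟨hBG, eRk_eq_three_of_indep_card hBind hBc⟩
    · obtain ⟨hBG, hBc⟩ := Finset.mem_powersetCard.1 hB
      exact ⟨hBG, eRk_eq_three_of_four_le_of_core hc hG hBG (by omega)⟩
    · obtain ⟨hBG, hBc⟩ := Finset.mem_powersetCard.1 hB
      exact ⟨hBG, eRk_eq_three_of_four_le_of_core hc hG hBG (by omega)⟩
    · rw [hBG']; exact ⟨le_rfl, hG3⟩
  · rw [Finset.disjoint_left]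
    intro B h3 h4
    have := (hmem3 B h3).2.1; have := hc4 B h4; omega
  · rw [Finset.disjoint_left]
    intro B hB h5
    have := hc5 B h5
    rcases Finset.mem_union.1 hB with h3 | h4
    · have := (hmem3 B h3).2.1; omega
    · have := hc4 B h4; omega
  · rw [Finset.disjoint_right]
    intro B hB
    rw [Finset.mem_singleton] at hB
    rw [hB]
    simp only [Finset.mem_union, not_or]
    refine ⟨⟨?_, ?_⟩, ?_⟩
    · intro h3; have := (hmem3 G h3).2.1; omega
    · intro h4; have := hc4 G h4; omega
    · intro h5; have := hc5 G h5; omega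
  · rw [Finset.card_erase_of_mem (Finset.mem_powersetCard.2 ⟨hℓG, hℓc⟩), Finset.card_powersetCard, hGc]; rfl
  · rw [Finset.card_powersetCard, hGc]; rfl
  · rw [Finset.card_powersetCard, hGc]; rfl

omit [M.Finite] in
/-- Summing over the `4`-subsets of the `6`-point plane by the line: `3` through `ℓ`, `12` not. -/
theorem sum_powersetCard_four_six {G ℓ : Finset α} (hℓG : ℓ ⊆ G) (hℓc : ℓ.card = 3) (hGc : G.card = 6)
    (g : Finset α → ℚ) {vL vg : ℚ}
    (hL : ∀ B ∈ G.powersetCard 4, ℓ ⊆ B → g B = vL) (hg : ∀ B ∈ G.powersetCard 4, ¬ ℓ ⊆ B → g B = vg) :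
    ∑ B ∈ G.powersetCard 4, g B = 3 * vL + 12 * vg := by
  classical
  set P := G.powersetCard 4 with hP
  have hPc : P.card = 15 := by rw [hP, Finset.card_powersetCard, hGc]; rfl
  have hcL : (P.filter (fun B => ℓ ⊆ B)).card = 3 := card_filter_four_line_six hℓG hℓc hGc
  have hcg : (P.filter (fun B => ¬ ℓ ⊆ B)).card = 12 := by
    have h1 := Finset.card_filter_add_card_filter_not (s := P) (fun B => ℓ ⊆ B)
    rw [hcL, hPc] at h1
    omega
  rw [← Finset.sum_filter_add_sum_filter_not P (fun B => ℓ ⊆ B),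
    Finset.sum_congr rfl (fun B hB => hL B (Finset.mem_filter.1 hB).1 (Finset.mem_filter.1 hB).2),
    Finset.sum_congr rfl (fun B hB => hg B (Finset.mem_filter.1 hB).1 (Finset.mem_filter.1 hB).2),
    Finset.sum_const, Finset.sum_const, hcL, hcg]
  simp only [nsmul_eq_mul]
  push_cast
  ring

omit [M.Finite] in
/-- Summing over the `5`-subsets of the `6`-point plane by the line: `3` through `ℓ`, `3` not. -/
theorem sum_powersetCard_five_six {G ℓ : Finset α} (hℓG : ℓ ⊆ G) (hℓc : ℓ.card = 3) (hGc : G.card = 6)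
    (g : Finset α → ℚ) {vL vg : ℚ}
    (hL : ∀ B ∈ G.powersetCard 5, ℓ ⊆ B → g B = vL) (hg : ∀ B ∈ G.powersetCard 5, ¬ ℓ ⊆ B → g B = vg) :
    ∑ B ∈ G.powersetCard 5, g B = 3 * vL + 3 * vg := by
  classical
  set P := G.powersetCard 5 with hP
  have hPc : P.card = 6 := by rw [hP, Finset.card_powersetCard, hGc]; rfl
  have hcL : (P.filter (fun B => ℓ ⊆ B)).card = 3 := card_filter_five_line_six hℓG hℓc hGc
  have hcg : (P.filter (fun B => ¬ ℓ ⊆ B)).card = 3 := by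
    have h1 := Finset.card_filter_add_card_filter_not (s := P) (fun B => ℓ ⊆ B)
    rw [hcL, hPc] at h1
    omega
  rw [← Finset.sum_filter_add_sum_filter_not P (fun B => ℓ ⊆ B),
    Finset.sum_congr rfl (fun B hB => hL B (Finset.mem_filter.1 hB).1 (Finset.mem_filter.1 hB).2),
    Finset.sum_congr rfl (fun B hB => hg B (Finset.mem_filter.1 hB).1 (Finset.mem_filter.1 hB).2),
    Finset.sum_const, Finset.sum_const, hcL, hcg]
  simp only [nsmul_eq_mul]
  push_cast
  ring

end NightThree

end PercRepro
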